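/-
Copyright: statement-level skeleton of a published paper (lit-balaban cell, Phase-2 proof seat p13, gen 9). No proof
claims beyond what the kernel checks below.
-/
import Literature.MathematicalPhysics.QuantumFieldTheory.BalabanImbrieJaffe1984to88.BIJ88Expansion577Bounds

/-!
# `BalabanImbrieJaffe1984to88.BIJ88ExpansionCoarsen577` — T. Bałaban, J. Imbrie, A. Jaffe, *Effective action and cluster
properties of the abelian Higgs model*, Commun. Math. Phys. **114** (1988) 257–315 [BalabanImbrieJaffe1988]: Sect. 5.7 —
the TWO CUBE SIZES of the regions: p. 289 *"To each b ∈ T_η and each collection of bonds b₁, …, b_m ∈ T^{(k)} we associate … a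
set X (a connected union of r(e_k)-cubes containing them)"* (the regions of `F_{1,j,b}(X)`, (5.7.5)–(5.7.7)) versus p. 289 *"the
generalized random walk expansion (2.45), modified slightly to use cubes of size L^{k−j}r(e_k) in T_{L^{−j}}"* and p. 294 *"As
always, X is a connected union of L^{k−j}r(e_k)-cubes"* (the regions of `W^{(j)}(X)`, (5.7.9)).  COARSENING an expansion along a
map of cubes `f : ι → ι′` (each `r(e_k)`-cube to the `L^{k−j}r(e_k)`-cube containing it) keeps the represented quantity and the
order-`≤ n̄` part, keeps rootedness and connectedness, and does not increase the localized size at any rate `κ ≥ 0` — so the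
(5.7.7) inputs on fine cubes (file 4 `BIJ88F1Expansion577`) feed the `W^{(j)}` split on coarse cubes (file 3 `BIJ88WSplit290`)
(file 5 of seat p13 gen 9).

statement-level skeleton of published theorems with citation tags; proofs where landed; nothing here is a claim about the Yang–Mills mass gap

PDF held: `paper:balaban1988-cmp114-bij-abelian-higgs-effective-action` (journal page = PDF page + 256); pp. 289–294
[PDF 33–38] read as IMAGES (CCITT renders; copies `HOME/lit-balaban-p13/pages/`).

CITATION HEADER (lean-in-tree rule).  Part of the lit-balaban TYPED SKELETON (HOME `run/shared/lean/pub/lit-balaban/`):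
WHAT IS REPRODUCED = row **C2.Eq5.7.7-5.7.9** of `HOME/lit-balaban-r16/ROWS-C2-part2.md`, the cube-size bookkeeping between
(5.7.7) and (5.7.9).  Unit `lit-balaban-p13` (gen 9), owner r16, referee ref-5.  Built BY NAME on 2a/2b (`GLExp`, `val`,
`Rooted`, `Conn`, `lowNormW`, `actNorm`), gen 8's `cubePolymers`, r16's `PolymerSys.cardMinus`, the tree's `IsRConnected`;
nothing restated.

## What is kernel-checked here

* `GLExp.coarsen f E` (localized part pushed forward along `X ↦ f(X)`), **`val_coarsen`** (same quantity), `low_coarsen`,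
  `lowNormW_coarsen` (same order-`≤ n̄` part and size), **`Rooted.coarsen`** (rooted at `f c₀`), **`Conn.coarsen`** (connected for
  any coarse adjacency `R′` with `R x y ⇒ R′ (f x) (f y) ∨ f x = f y`), `cardMinus_image_le` (`|f(X)|⁻ ≤ |X|⁻`) and
  **`actNorm_coarsen_le`** (`actNorm κ (coarsen f E) ≤ actNorm κ E` for `κ ≥ 0`: coarser regions only lose decay exponent).

HONEST SCOPE.  Pure bookkeeping at model level; the cube maps of the print (`r(e_k)`-cubes into `L^{k−j}r(e_k)`-cubes, rescaling
`T^{(k)} → T_{L^{−j}}`) are inputs.  Definitions with bodies (`coarsen`) + theorems; no `Prop` facts; axioms standard.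
-/

noncomputable section

open scoped BigOperators
open Finset

namespace Literature.MathematicalPhysics.QuantumFieldTheory.BalabanImbrieJaffe1984to88.BIJ88ExpansionCoarsen577

open BIJ88TraceTerms579 (cubePolymers)
open BIJ88Sect5StatementsPart2 (PolymerSys)
open BIJ88Expansion577 BIJ88Expansion577.GLExp BIJ88Expansion577Bounds
open Literature.Probability.LatticeModels (IsRConnected)

variable {ι ι' : Type} [Fintype ι] [DecidableEq ι']

/-- **COARSENING** an expansion along a map of cubes `f` (fine cube ↦ the coarse cube containing it): the order-`≤ n̄` part is
kept, the part localized in the fine region `X` is re-assigned to the coarse region `f(X)`.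
[cite: BalabanImbrieJaffe1988, (5.7.9) p.291, p.294] -/
def coarsen (f : ι → ι') (E : GLExp ι) : GLExp ι' :=
  ⟨E.low, fun X' => ∑ X ∈ (univ : Finset (Finset ι)).filter (fun X => X.image f = X'), E.act X⟩

variable (f : ι → ι') (E : GLExp ι)

/-- the order-`≤ n̄` coefficients are unchanged. [cite: BalabanImbrieJaffe1988, (5.7.9) p.291] -/
theorem low_coarsen (n : ℕ) : (coarsen f E).low n = E.low n := rfl

/-- **the represented quantity is unchanged**: `val (coarsen f E) = val E` (fibrewise regrouping of `Σ_X act X`).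
[cite: BalabanImbrieJaffe1988, (5.7.9) p.291] -/
theorem val_coarsen [Fintype ι'] (nbar : ℕ) (ε : ℝ) : (coarsen f E).val nbar ε = E.val nbar ε := by
  unfold GLExp.val GLExp.lowVal GLExp.actVal coarsen
  congr 1
  exact Finset.sum_fiberwise_of_maps_to (g := fun X : Finset ι => X.image f) (fun _ _ => Finset.mem_univ _) _

/-- the weighted size of the order-`≤ n̄` part is unchanged. [cite: BalabanImbrieJaffe1988, (5.7.9) p.291] -/
theorem lowNormW_coarsen (ρ : ℝ) (nbar : ℕ) :
    lowNormW ρ nbar (coarsen f E) = lowNormW ρ nbar E := rfl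

/-- **rootedness is transported**: rooted at `c₀` ⇒ the coarsening is rooted at `f c₀`.
[cite: BalabanImbrieJaffe1988, (5.7.9) p.291] -/
theorem Rooted.coarsen {c₀ : ι} (hE : Rooted c₀ E) : Rooted (f c₀) (coarsen f E) := by
  intro X' hX'
  obtain ⟨X, hX, hne⟩ := Finset.exists_ne_zero_of_sum_ne_zero hX'
  rw [← (Finset.mem_filter.mp hX).2]
  exact Finset.mem_image_of_mem f (hE X hne)

omit [Fintype ι] in
/-- the image of an `R`-connected cube set under a map compatible with the adjacencies (`R x y ⇒ R′ (f x) (f y)` or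
`f x = f y`) is `R′`-connected. [folklore] -/
private theorem isRConnected_image {R : ι → ι → Prop} {R' : ι' → ι' → Prop}
    (hf : ∀ x y, R x y → R' (f x) (f y) ∨ f x = f y) {X : Finset ι} (hX : IsRConnected R X) :
    IsRConnected R' (X.image f) := by
  obtain ⟨⟨z, hz⟩, hpath⟩ := hX
  refine ⟨⟨f z, Finset.mem_image_of_mem f hz⟩, fun v' hv' w' hw' => ?_⟩
  obtain ⟨v, hv, rfl⟩ := Finset.mem_image.mp hv'
  obtain ⟨w, hw, rfl⟩ := Finset.mem_image.mp hw'
  have key : ∀ {a b : ι}, Relation.ReflTransGen (fun x y => R x y ∧ x ∈ X ∧ y ∈ X) a b →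
      Relation.ReflTransGen (fun x y => R' x y ∧ x ∈ X.image f ∧ y ∈ X.image f) (f a) (f b) := by
    intro a b h
    induction h with
    | refl => exact Relation.ReflTransGen.refl
    | tail _ hbc ih =>
        rcases hf _ _ hbc.1 with h' | h'
        · exact ih.tail ⟨h', Finset.mem_image_of_mem f hbc.2.1, Finset.mem_image_of_mem f hbc.2.2⟩
        · rw [← h']; exact ih
  exact key (hpath v hv w hw)

/-- **connectedness is transported**: the regions stay connected unions of (coarse) cubes — p. 294 *"As always, X is a
connected union of L^{k−j}r(e_k)-cubes"*. [cite: BalabanImbrieJaffe1988, (5.7.9) p.291, p.294] -/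
theorem Conn.coarsen {R : ι → ι → Prop} {R' : ι' → ι' → Prop} (hf : ∀ x y, R x y → R' (f x) (f y) ∨ f x = f y)
    (hE : Conn R E) : Conn R' (coarsen f E) := by
  intro X' hX'
  obtain ⟨X, hX, hne⟩ := Finset.exists_ne_zero_of_sum_ne_zero hX'
  rw [← (Finset.mem_filter.mp hX).2]
  exact isRConnected_image f hf (hE X hne)

omit [Fintype ι] in
/-- coarser regions have fewer cubes: `|f(X)|⁻ ≤ |X|⁻`. [cite: BalabanImbrieJaffe1988, (5.7.9) p.291] -/
theorem cardMinus_image_le (X : Finset ι) :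
    (cubePolymers ι').cardMinus (X.image f) ≤ (cubePolymers ι).cardMinus X := by
  show (X.image f).card - 1 ≤ X.card - 1
  exact Nat.sub_le_sub_right Finset.card_image_le 1

/-- **THE LOCALIZED SIZE DOES NOT INCREASE**: `actNorm κ (coarsen f E) ≤ actNorm κ E` for `κ ≥ 0` (triangle inequality on the
fibres and `|f(X)|⁻ ≤ |X|⁻`). [cite: BalabanImbrieJaffe1988, (5.7.9) p.291] -/
theorem actNorm_coarsen_le [Fintype ι'] {κ : ℝ} (hκ : 0 ≤ κ) : (coarsen f E).actNorm κ ≤ E.actNorm κ := by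
  unfold GLExp.actNorm coarsen
  calc ∑ X' : Finset ι', ‖∑ X ∈ (univ : Finset (Finset ι)).filter (fun X => X.image f = X'), E.act X‖ *
          Real.exp (κ * (cubePolymers ι').cardMinus X')
      ≤ ∑ X' : Finset ι', ∑ X ∈ (univ : Finset (Finset ι)).filter (fun X => X.image f = X'),
          ‖E.act X‖ * Real.exp (κ * (cubePolymers ι).cardMinus X) := by
        refine Finset.sum_le_sum fun X' _ => ?_
        refine (mul_le_mul_of_nonneg_right (norm_sum_le _ _) (Real.exp_pos _).le).trans ?_
        rw [Finset.sum_mul]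
        refine Finset.sum_le_sum fun X hX => mul_le_mul_of_nonneg_left ?_ (norm_nonneg _)
        rw [← (Finset.mem_filter.mp hX).2, Real.exp_le_exp]
        exact mul_le_mul_of_nonneg_left (by exact_mod_cast cardMinus_image_le f X) hκ
    _ = ∑ X : Finset ι, ‖E.act X‖ * Real.exp (κ * (cubePolymers ι).cardMinus X) :=
        Finset.sum_fiberwise_of_maps_to (g := fun X : Finset ι => X.image f) (fun _ _ => Finset.mem_univ _) _

end Literature.MathematicalPhysics.QuantumFieldTheory.BalabanImbrieJaffe1984to88.BIJ88ExpansionCoarsen577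

end
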